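import Literature.AnabelianGeometry.EtaleTheta.Discharge.Sec2DtauInversionStable
import Literature.AnabelianGeometry.EtaleTheta.SettingModelChiCuspSectionData
import HarnessLib

/-!
# The cusped χ-model `modelχ′`: the DEF. 1.9 POINTS `τ^{±1}` (anchored `K̈`-points of `Ÿ` at the `κ_u²`-twisted sections,
# `Ü(τ^{±1}) = (√−1)^{±1}`) and the `Dtau`-clause NON-VACUITY of R374 AT THESE POINTS (class (b): three definitions)

S. Mochizuki, *The étale theta function and its Frobenioid-theoretic manifestations*, Publ. RIMS **45** (2009) [EtTh], §1,
Prop. 1.4 (iii) p. 22 («if `y ∈ Ÿ(L)` is a non-cuspidal point …»), Def. 1.9 p. 29 («`√−1` determines a 4-torsion point `τ` …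
the 4-torsion point `τ⁻¹` determined by `−√−1`»), Rmk. 1.9.1 p. 29; §2 Def. 2.7 p. 41, Cor. 2.8 (i) p. 42
[cite: MochizukiEtTh2009, Def 1.9 p.29].

abc-iut cell, layer L2, seat abc-iut-w5-d118 (gen 6); abc-iut-L2-lead rows R374 / R498 (FILE A). Class (b) CONSTRUCTION file
over FROZEN interfaces: three definitions (`anchoredPointχ'OfUnit`, `tauχ'`, `tauInvχ'`) on abc-iut-L2-t1/L2-t12's EXISTING
structures `ThetaSetting.AnchoredPoint` / `NonCuspidalPoint`; no new structure, no instance, no `Prop` fact, no interface clause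
touched. It is abc-iut-L2-t6's `anchoredPointχ` (`SettingModelChiAnchoredPoints`, over `modelχ`) RE-TYPED over abc-iut-w5-d171's
cusped core `kummerCoreχ′` / abc-iut-L2-t6 g7's section datum `kummerDataχ′Sec` EXACTLY as abc-iut-L2-t10's `nonCuspidalPointχ′`
(coordinate `1 + p`, untwisted section `inr`; `SettingModelChiCuspSectionData`) and abc-iut-w5-d029's `cuspidalPointDdχ′`
(`ThetaCohomologyCuspSectionPoints`) re-typed their `modelχ` originals: the carriers `Π^tp_X`, `Π^tp_Ÿ`, `G_K̈`, `K̈`, `q̈`,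
`Δ_Θ`, `toTheta`, `log(Ü)` of `modelχ′` are those of `modelχ` (`rfl`), so abc-iut-L2-t6's section lemmas (`sectionOfUnitχ`,
`continuous_sectionOfUnitχ`, `aug_modelχ_sectionOfUnitχ`, `map_sectionOfUnitχ_GKdd_le_GtpYdd`, the ANCHOR
`comap_sectionOfUnitχ_logUdd`) and abc-iut-w5-d140's `√−1` units (`sqrtNegOneUnitχ`, `sqrtNegOneInvUnitχ`, `…_ne_cusp`;
`Discharge/Sec1Thm110ModelChiNV`) are consumed BY NAME, nothing restated.

* `anchoredPointχ'OfUnit u hu : AnchoredPoint (kummerDataχ′Sec p)` — `D_y := s_u(G_K̈)` (the `κ_u²`-twisted section),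
  `Ü(y) := u`, anchored (`log(Ü)|_y = u`); `Dpt_…` / `coord_…` (`rfl`);
* `tauχ' hp`, `tauInvχ' hp` (`p ≡ 1 (mod 4)`; `u := √−1`, `(√−1)⁻¹`): THE Def. 1.9 pair at `χ′`; `Dpt_tauInvχ'_eq_map_inv` (its
  decomposition group is `s_{(√−1)⁻¹}(G_K̈)` for the INVERSE UNIT, via this seat's `sqrtNegOneInvUnitχ_eq_inv`);
* **`exists_orbitEmbedding_dtau_stable_tauχ'`** — R374 NON-VACUITY WITH RESIDUAL ∅ at `inversionModelχ′`: for `p ≡ 1 (4)` and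
  every odd `l` there are a `TemperedCoverData` ON `Π^tp_C(inversionModelχ′)`, an `OrbitEmbedding` of abc-iut-L2-t10's
  `doubleUnderlineχ′Sec` (`Π^tp_{X̲̲} = Huuχ p l`, theta class `etaDdχ ≠ 1`) whose points ARE `τ^{±1}`, and `Γ := γ_{ε_±} ≠ id`
  restricting to the twisted inversion, such that `∃ v ∈ Π^tp_{X̲̲}, ∀ Dt ∈ Dtau, (Γ ≫ γ_{ι v})(Dt) ∈ Dtau` (this seat's
  `exists_orbitEmbedding_dtau_stable_inversionModelχ'`, `Discharge/Sec2DtauInversionStable`).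

HONEST FRAMING: SEMI-SYNTHETIC model (the χ-twisted root with a synthetic toral cusp and abc-iut-L2-t10's SYNTHETIC mod-`l` cusp
datum; not the tempered `π₁` of an orbicurve) — consistency / non-vacuity evidence for OUR typed interface ONLY; the `∀ Γ` binder of
R374 is NOT discharged (only its `ε_±` class); nothing of [EtTh] is asserted; typed ≠ proved; no side is taken on [IUTchIII] Cor. 3.12.
-/

noncomputable section

namespace Literature.AnabelianGeometry.EtaleTheta.SettingModel

open Literature.AnabelianGeometry.SemiGraphs ThetaCovers
open _root_.Topology _root_.Function

variable (p : ℕ) [Fact p.Prime]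

/-! ### Anchored points of `Ÿ(K̈)` at `modelχ′` with prescribed coordinate -/

/-- **An ANCHORED `K̈`-point of `Ÿ` at `modelχ′` with coordinate `u` off the cusps**: decomposition group the
`κ_u²`-twisted section `s_u(G_K̈)`, `Ü(y) := u`, evaluation the pull-back along the section, anchor `log(Ü)|_y = u`
(abc-iut-L2-t6's `anchoredPointOfSections`, over the cusped core). DEFINED. [cite: MochizukiEtTh2009, Prop 1.4 (iii) p.22] -/
def anchoredPointχ'OfUnit (u : (↥(ThetaSetting.modelχ p).Kdd)ˣ)
    (hu : ∀ a : ℤ, ((u : (ThetaSetting.modelχ p).Kdd) : PadicAlgCl p) ≠ (ThetaSetting.modelχ p).qdd ^ a ∧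
      ((u : (ThetaSetting.modelχ p).Kdd) : PadicAlgCl p) ≠ -((ThetaSetting.modelχ p).qdd ^ a)) :
    ThetaSetting.AnchoredPoint (kummerDataχ'Sec p) :=
  (kummerCoreχ' p).anchoredPointOfSections SemidirectProduct.inr (continuous_inr_modelχ p) (aug_modelχ_inr p)
    (map_inr_GK_le_GtpY_modelχ p) (map_inr_GKdd_le_GtpYdd_modelχ p) (sectionOfUnitχ p u)
    (continuous_sectionOfUnitχ p u) (aug_modelχ_sectionOfUnitχ p u) (map_sectionOfUnitχ_GKdd_le_GtpYdd p u) u hu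
    (comap_sectionOfUnitχ_logUdd p u)

/-- Its decomposition group is `s_u(G_K̈)`. [cite: MochizukiEtTh2009, Prop 1.4 (iii) p.22] -/
theorem Dpt_anchoredPointχ'OfUnit (u : (↥(ThetaSetting.modelχ p).Kdd)ˣ)
    (hu : ∀ a : ℤ, ((u : (ThetaSetting.modelχ p).Kdd) : PadicAlgCl p) ≠ (ThetaSetting.modelχ p).qdd ^ a ∧
      ((u : (ThetaSetting.modelχ p).Kdd) : PadicAlgCl p) ≠ -((ThetaSetting.modelχ p).qdd ^ a)) :
    (anchoredPointχ'OfUnit p u hu).Dpt = (ThetaSetting.modelχ p).GKdd.map (sectionOfUnitχ p u) := rfl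

/-- Its coordinate is `u`. [cite: MochizukiEtTh2009, Prop 1.4 (iii) p.22] -/
@[simp] theorem coord_anchoredPointχ'OfUnit (u : (↥(ThetaSetting.modelχ p).Kdd)ˣ)
    (hu : ∀ a : ℤ, ((u : (ThetaSetting.modelχ p).Kdd) : PadicAlgCl p) ≠ (ThetaSetting.modelχ p).qdd ^ a ∧
      ((u : (ThetaSetting.modelχ p).Kdd) : PadicAlgCl p) ≠ -((ThetaSetting.modelχ p).qdd ^ a)) :
    (anchoredPointχ'OfUnit p u hu).coord = u := rfl

/-- CENSUS: `AnchoredPoint → WITNESSED at modelχ′` (coordinate `1 + p`). [cite: MochizukiEtTh2009, Prop 1.4 (iii) p.22] -/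
theorem nonempty_anchoredPoint_kummerDataχ'Sec : Nonempty (ThetaSetting.AnchoredPoint (kummerDataχ'Sec p)) :=
  ⟨anchoredPointχ'OfUnit p (onePlusP p) (onePlusP_ne_cusp p)⟩

/-! ### The Def. 1.9 pair `τ^{±1}` at `modelχ′` (`p ≡ 1 (mod 4)`) -/

/-- **`τ := anchoredPointχ′ (√−1)`**: `D_τ = s_{√−1}(G_K̈)`, `Ü(τ) = √−1`. DEFINED. [cite: MochizukiEtTh2009, Def 1.9 p.29] -/
abbrev tauχ' (hp : p % 4 = 1) : ThetaSetting.AnchoredPoint (kummerDataχ'Sec p) :=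
  anchoredPointχ'OfUnit p (sqrtNegOneUnitχ p hp) (sqrtNegOneUnitχ_ne_cusp p hp)

/-- **`τ⁻¹ := anchoredPointχ′ (√−1)⁻¹`**: `Ü(τ⁻¹) = (√−1)⁻¹ = −√−1`. DEFINED. [cite: MochizukiEtTh2009, Def 1.9 p.29] -/
abbrev tauInvχ' (hp : p % 4 = 1) : ThetaSetting.AnchoredPoint (kummerDataχ'Sec p) :=
  anchoredPointχ'OfUnit p (sqrtNegOneInvUnitχ p hp) (sqrtNegOneInvUnitχ_ne_cusp p hp)

/-- `D_τ = s_{√−1}(G_K̈)`. [cite: MochizukiEtTh2009, Def 1.9 p.29] -/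
theorem Dpt_tauχ' (hp : p % 4 = 1) :
    (tauχ' p hp).Dpt = (ThetaSetting.modelχ p).GKdd.map (sectionOfUnitχ p (sqrtNegOneUnitχ p hp)) := rfl

/-- `D_{τ⁻¹} = s_{(√−1)⁻¹}(G_K̈)` for the INVERSE UNIT `(sqrtNegOneUnitχ)⁻¹` (this seat's `sqrtNegOneInvUnitχ_eq_inv`).
[cite: MochizukiEtTh2009, Def 1.9 p.29] -/
theorem Dpt_tauInvχ'_eq_map_inv (hp : p % 4 = 1) :
    (tauInvχ' p hp).Dpt = (ThetaSetting.modelχ p).GKdd.map (sectionOfUnitχ p (sqrtNegOneUnitχ p hp)⁻¹) := by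
  rw [← sqrtNegOneInvUnitχ_eq_inv]
  rfl

/-- The two points at `modelχ′` package as `NonCuspidalPoint`s of the datum carrying the model's theta class
(abc-iut-L2-t10's `doubleUnderlineχ′Sec` lives over `(kummerDataχ′Sec p).etaleThetaDataOfClass (etaDdχ p)`).
[cite: MochizukiEtTh2009, Def 2.7 p.41] -/
theorem nonempty_orbitEmbedding_doubleUnderlineχ'Sec_tauχ' (hp : p % 4 = 1) (l : ℕ+) (hodd : Odd (l : ℕ)) :
    ∃ T : TemperedCoverData.{0} l, T.Gtp = (MuTwoSetting.inversionModelχ' p).GtpC ∧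
      Nonempty ((doubleUnderlineχ'Sec p l hodd).OrbitEmbedding T) :=
  nonempty_orbitEmbedding_inversionModelχ'_of_Huu_eq p hodd (doubleUnderlineχ'Sec p l hodd) rfl
    (tauχ' p hp).toNonCuspidalPoint (tauInvχ' p hp).toNonCuspidalPoint

/-! ### R374 non-vacuity at the Def. 1.9 pair: residual ∅ -/

/-- **R374 «hDtau′ (INNER-ADJUSTED) WITNESS AT THE MODEL» — RESIDUAL ∅ at `inversionModelχ′`, `p ≡ 1 (mod 4)`.** For every odd
`l` there are a `TemperedCoverData` `T` ON `Π^tp_C(inversionModelχ′)`, an orbit embedding `ε` of abc-iut-L2-t10's `doubleUnderlineχ′Sec`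
(`Π^tp_{X̲̲} = Huuχ p l`) whose points ARE the Def. 1.9 pair `τ^{±1}` (`Ü = (√−1)^{±1}`), and `Γ := γ_{ε_±} ≠ id` restricting along
`ε.ι = inclX` to the twisted inversion, such that the inner-adjusted `Dtau`-clause HOLDS for `Γ`:
`∃ v ∈ Π^tp_{X̲̲}, ∀ Dt ∈ Dtau, (Γ ≫ γ_{ι v})(Dt) ∈ Dtau`. [cite: MochizukiEtTh2009, Rmk 1.9.1 p.29] -/
theorem exists_orbitEmbedding_dtau_stable_tauχ' (hp : p % 4 = 1) (l : ℕ+) (hodd : Odd (l : ℕ)) :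
    ∃ (T : TemperedCoverData.{0} l) (ε : (doubleUnderlineχ'Sec p l hodd).OrbitEmbedding T) (Γ : T.Gtp ≃ₜ* T.Gtp),
      T.Gtp = (MuTwoSetting.inversionModelχ' p).GtpC ∧ ε.tau = (tauχ' p hp).toNonCuspidalPoint ∧
      ε.tauInv = (tauInvχ' p hp).toNonCuspidalPoint ∧ (∀ x, Γ (ε.ι x) = ε.ι (twistedInversion (chi p) x)) ∧
      Γ ≠ ContinuousMulEquiv.refl _ ∧
      ∃ v ∈ (doubleUnderlineχ'Sec p l hodd).Huu,
        ∀ Dt ∈ (ThetaOrbitData.ofEmbedding ε (ThetaSetting.modelχ' p).compat (ThetaSetting.modelχ'_sec2Hyps p)).Dtau,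
          Dt.map (Γ.trans (ThetaOrbitData.innerAutTop (ε.ι v))).toMulEquiv.toMonoidHom ∈
            (ThetaOrbitData.ofEmbedding ε (ThetaSetting.modelχ' p).compat (ThetaSetting.modelχ'_sec2Hyps p)).Dtau :=
  exists_orbitEmbedding_dtau_stable_inversionModelχ' p hodd (doubleUnderlineχ'Sec p l hodd) rfl
    (ThetaSetting.modelχ' p).compat (ThetaSetting.modelχ'_sec2Hyps p) (sqrtNegOneUnitχ p hp)
    (tauχ' p hp).toNonCuspidalPoint (tauInvχ' p hp).toNonCuspidalPoint rfl (Dpt_tauInvχ'_eq_map_inv p hp)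

end Literature.AnabelianGeometry.EtaleTheta.SettingModel

end
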